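import Summits.AtomisticToContinuum.BoseEinsteinCondensation.Theorems.BECCellInformationOneBodyEntropyBoundDenseCellIMS

/-!
# Crux `OneBodyEntropyBound` — line `registered`, residual (general insertion), lead's calculus for the first variation

Support file (`--supports stmt-AtomisticToContinuum-13440`, lead c2). Pointwise calculus of the multiplication of an
`n`-body wave function `ψ` by a REAL `C¹` scalar field `H` on configuration space (a Jastrow factor): the product rule, the real
expansion of the kinetic density `|∇(Hψ)|² = |∇H|²|ψ|² + H²|∇ψ|² + 2H Σ ∂H·⟨ψ,∂ψ⟩`, the potential identity
`V|Hψ|² = H² V|ψ|²`, a two-sided domination of the cross density, and the finiteness of the energy of `Hψ` for bounded `H`, `∇H`.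
Used by the first-variation (approximate ground-state representation) lemma for near-minimisers.
-/

noncomputable section

namespace Summit.AtomisticToContinuum.BoseEinsteinCondensation.Cruxes.OneBodyEntropyBound.Birth

namespace FVCalc

open MeasureTheory Filter Topology
open scoped ENNReal NNReal
open Literature.MathematicalPhysics.QuantumManyBody.BoseGas

variable {n : ℕ}

/-! ### Product rule for a real scalar field times a complex wave function -/

/-- `X ↦ (H X : ℂ) ψ X` is `C¹` for `C¹` real `H` and complex `ψ`. [folklore] -/
theorem contDiff_realMul {H : Config n → ℝ} (hH : ContDiff ℝ 1 H) {ψ : Config n → ℂ} (hψ : ContDiff ℝ 1 ψ) :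
    ContDiff ℝ 1 fun X : Config n => (H X : ℂ) * ψ X :=
  (Complex.ofRealCLM.contDiff.comp hH).mul hψ

/-- Product rule: `∂_V((H:ℂ)ψ) = (∂_V H : ℂ) ψ + H ∂_V ψ`. [folklore] -/
theorem fderiv_realMul_apply {H : Config n → ℝ} (hH : Differentiable ℝ H) {ψ : Config n → ℂ}
    (hψ : Differentiable ℝ ψ) (X V : Config n) :
    fderiv ℝ (fun X : Config n => (H X : ℂ) * ψ X) X V =
      (fderiv ℝ H X V : ℂ) * ψ X + (H X : ℂ) * fderiv ℝ ψ X V := by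
  have hg : HasFDerivAt (fun X : Config n => (H X : ℂ)) (Complex.ofRealCLM.comp (fderiv ℝ H X)) X :=
    Complex.ofRealCLM.hasFDerivAt.comp X (hH X).hasFDerivAt
  have h : HasFDerivAt (fun X : Config n => (H X : ℂ) * ψ X) _ X := hg.mul (hψ X).hasFDerivAt
  rw [h.fderiv]
  simp only [add_apply, smul_apply, ContinuousLinearMap.coe_comp, Function.comp_apply,
    Complex.ofRealCLM_apply, smul_eq_mul]
  ring

/-- `‖a z + c w‖² = a²‖z‖² + 2 a c ⟨z, w⟩ + c²‖w‖²` for real `a, c` and complex `z, w`. [folklore] -/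
theorem normSq_real_lin (a c : ℝ) (z w : ℂ) :
    ‖(a : ℂ) * z + (c : ℂ) * w‖ ^ 2 = a ^ 2 * ‖z‖ ^ 2 + 2 * (a * c * inner ℝ z w) + c ^ 2 * ‖w‖ ^ 2 := by
  have hz : (a : ℂ) * z = a • z := by rw [Complex.real_smul]
  have hw : (c : ℂ) * w = c • w := by rw [Complex.real_smul]
  rw [hz, hw, norm_add_sq_real, norm_smul, norm_smul, real_inner_smul_left, real_inner_smul_right,
    Real.norm_eq_abs, Real.norm_eq_abs, mul_pow, mul_pow, sq_abs, sq_abs]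
  ring

/-! ### Real forms of the kinetic density -/

/-- The kinetic density is the (finite) sum of the squared norms of the partial derivatives: its `toReal`. [folklore] -/
theorem kineticDensity_toReal (φ : Config n → ℂ) (X : Config n) :
    (kineticDensity φ X).toReal =
      ∑ i : Fin n, ∑ k : Fin 3, ‖fderiv ℝ φ X (Pi.single i (EuclideanSpace.single k (1 : ℝ)))‖ ^ 2 := by
  unfold kineticDensity
  rw [ENNReal.toReal_sum (fun i _ => ENNReal.sum_ne_top.2 fun k _ => ENNReal.pow_ne_top ENNReal.coe_ne_top)]
  refine Finset.sum_congr rfl fun i _ => ?_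
  rw [ENNReal.toReal_sum (fun k _ => ENNReal.pow_ne_top ENNReal.coe_ne_top)]
  refine Finset.sum_congr rfl fun k _ => ?_
  rw [coe_nnnorm_pow_two_eq_ofReal, ENNReal.toReal_ofReal (sq_nonneg _)]

/-- The kinetic density is finite. [folklore] -/
theorem kineticDensity_ne_top (φ : Config n → ℂ) (X : Config n) : kineticDensity φ X ≠ ⊤ :=
  ENNReal.sum_ne_top.2 fun _ _ => ENNReal.sum_ne_top.2 fun _ _ => ENNReal.pow_ne_top ENNReal.coe_ne_top

/-- The kinetic density as `ofReal` of its real form. [folklore] -/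
theorem kineticDensity_eq_ofReal (φ : Config n → ℂ) (X : Config n) :
    kineticDensity φ X = ENNReal.ofReal
      (∑ i : Fin n, ∑ k : Fin 3, ‖fderiv ℝ φ X (Pi.single i (EuclideanSpace.single k (1 : ℝ)))‖ ^ 2) := by
  rw [← kineticDensity_toReal, ENNReal.ofReal_toReal (kineticDensity_ne_top φ X)]

/-- **Real expansion of the kinetic density of `Hψ`.** With `∂ = ∂_{ik}` ranging over particles and axes:
`|∇(Hψ)|² = (Σ (∂H)²)|ψ|² + H²|∇ψ|² + 2H Σ ∂H·⟨ψ, ∂ψ⟩_ℝ`. [folklore] -/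
theorem kineticDensity_realMul_toReal {H : Config n → ℝ} (hH : Differentiable ℝ H) {ψ : Config n → ℂ}
    (hψ : Differentiable ℝ ψ) (X : Config n) :
    (kineticDensity (fun X : Config n => (H X : ℂ) * ψ X) X).toReal =
      (∑ i : Fin n, ∑ k : Fin 3, (fderiv ℝ H X (Pi.single i (EuclideanSpace.single k (1 : ℝ)))) ^ 2) * ‖ψ X‖ ^ 2 +
        (H X) ^ 2 * (kineticDensity ψ X).toReal +
        2 * H X * ∑ i : Fin n, ∑ k : Fin 3,
          fderiv ℝ H X (Pi.single i (EuclideanSpace.single k (1 : ℝ))) *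
            inner ℝ (ψ X) (fderiv ℝ ψ X (Pi.single i (EuclideanSpace.single k (1 : ℝ)))) := by
  rw [kineticDensity_toReal, kineticDensity_toReal]
  have hterm : ∀ (i : Fin n) (k : Fin 3),
      ‖fderiv ℝ (fun X : Config n => (H X : ℂ) * ψ X) X (Pi.single i (EuclideanSpace.single k (1 : ℝ)))‖ ^ 2 =
        (fderiv ℝ H X (Pi.single i (EuclideanSpace.single k (1 : ℝ)))) ^ 2 * ‖ψ X‖ ^ 2 +
          (H X) ^ 2 * ‖fderiv ℝ ψ X (Pi.single i (EuclideanSpace.single k (1 : ℝ)))‖ ^ 2 +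
          (2 * H X) * (fderiv ℝ H X (Pi.single i (EuclideanSpace.single k (1 : ℝ))) *
            inner ℝ (ψ X) (fderiv ℝ ψ X (Pi.single i (EuclideanSpace.single k (1 : ℝ))))) := by
    intro i k
    rw [fderiv_realMul_apply hH hψ, normSq_real_lin]
    ring
  simp_rw [hterm]
  simp only [Finset.sum_add_distrib, ← Finset.sum_mul, ← Finset.mul_sum]

/-- The potential identity `V |Hψ|² = H² · V|ψ|²` in `ℝ≥0∞`. [folklore] -/
theorem interaction_mul_ennnorm_realMul_sq (v : ℝ → ℝ≥0∞) (H : Config n → ℝ) (ψ : Config n → ℂ) (X : Config n) :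
    interaction v X * (‖(H X : ℂ) * ψ X‖₊ : ℝ≥0∞) ^ 2 =
      ENNReal.ofReal ((H X) ^ 2) * (interaction v X * (‖ψ X‖₊ : ℝ≥0∞) ^ 2) := by
  rw [DenseCell.ennnorm_real_mul_sq]
  ring

/-! ### Bounds: gradient sums, cross density, kinetic density of `Hψ` -/

/-- A directional derivative along a unit tangent vector `e_{ik}` is bounded by the operator norm. [folklore] -/
theorem abs_fderiv_single_le {H : Config n → ℝ} (X : Config n) (i : Fin n) (k : Fin 3) :
    |fderiv ℝ H X (Pi.single i (EuclideanSpace.single k (1 : ℝ)))| ≤ ‖fderiv ℝ H X‖ := by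
  have h := (fderiv ℝ H X).le_opNorm (Pi.single i (EuclideanSpace.single k (1 : ℝ)))
  rw [Real.norm_eq_abs] at h
  refine h.trans ?_
  have hn : ‖(Pi.single i (EuclideanSpace.single k (1 : ℝ)) : Config n)‖ ≤ 1 := by
    refine (pi_norm_le_iff_of_nonneg zero_le_one).2 fun j => ?_
    by_cases hj : j = i
    · subst hj
      rw [Pi.single_eq_same, EuclideanSpace.single, PiLp.norm_single, norm_one]
    · rw [Pi.single_eq_of_ne hj, norm_zero]
      exact zero_le_one
  calc ‖fderiv ℝ H X‖ * ‖(Pi.single i (EuclideanSpace.single k (1 : ℝ)) : Config n)‖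
      ≤ ‖fderiv ℝ H X‖ * 1 := by gcongr
    _ = ‖fderiv ℝ H X‖ := mul_one _

/-- `Σ_{ik} (∂_{ik}H)² ≤ 3 n D²` when `‖∇H‖_op ≤ D`. [folklore] -/
theorem sum_sq_fderiv_le {H : Config n → ℝ} {D : ℝ} (hD : ∀ X, ‖fderiv ℝ H X‖ ≤ D) (X : Config n) :
    ∑ i : Fin n, ∑ k : Fin 3, (fderiv ℝ H X (Pi.single i (EuclideanSpace.single k (1 : ℝ)))) ^ 2 ≤
      3 * n * D ^ 2 := by
  have hD0 : 0 ≤ D := (norm_nonneg _).trans (hD X)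
  calc ∑ i : Fin n, ∑ k : Fin 3, (fderiv ℝ H X (Pi.single i (EuclideanSpace.single k (1 : ℝ)))) ^ 2
      ≤ ∑ _i : Fin n, ∑ _k : Fin 3, D ^ 2 := by
        refine Finset.sum_le_sum fun i _ => Finset.sum_le_sum fun k _ => ?_
        have h := (abs_fderiv_single_le (H := H) X i k).trans (hD X)
        rw [← sq_abs]
        exact pow_le_pow_left₀ (abs_nonneg _) h 2
    _ = 3 * n * D ^ 2 := by
        simp only [Finset.sum_const, Finset.card_univ, Fintype.card_fin, nsmul_eq_mul]
        push_cast
        ring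

/-- **Cross density domination**: `|Σ ∂H·⟨ψ,∂ψ⟩| ≤ ((Σ(∂H)²)|ψ|² + |∇ψ|²)/2`. [folklore] -/
theorem abs_cross_le (H : Config n → ℝ) (ψ : Config n → ℂ) (X : Config n) :
    |∑ i : Fin n, ∑ k : Fin 3,
        fderiv ℝ H X (Pi.single i (EuclideanSpace.single k (1 : ℝ))) *
          inner ℝ (ψ X) (fderiv ℝ ψ X (Pi.single i (EuclideanSpace.single k (1 : ℝ))))| ≤
      ((∑ i : Fin n, ∑ k : Fin 3, (fderiv ℝ H X (Pi.single i (EuclideanSpace.single k (1 : ℝ)))) ^ 2) * ‖ψ X‖ ^ 2 +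
        (kineticDensity ψ X).toReal) / 2 := by
  rw [kineticDensity_toReal, Finset.sum_mul, ← Finset.sum_add_distrib, Finset.sum_div]
  refine (Finset.abs_sum_le_sum_abs _ _).trans (Finset.sum_le_sum fun i _ => ?_)
  rw [Finset.sum_mul, ← Finset.sum_add_distrib, Finset.sum_div]
  refine (Finset.abs_sum_le_sum_abs _ _).trans (Finset.sum_le_sum fun k _ => ?_)
  set a := fderiv ℝ H X (Pi.single i (EuclideanSpace.single k (1 : ℝ)))
  set w := fderiv ℝ ψ X (Pi.single i (EuclideanSpace.single k (1 : ℝ)))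
  have h1 : |inner ℝ (ψ X) w| ≤ ‖ψ X‖ * ‖w‖ := abs_real_inner_le_norm _ _
  rw [abs_mul]
  have h2 : |a| * |inner ℝ (ψ X) w| ≤ |a| * (‖ψ X‖ * ‖w‖) := mul_le_mul_of_nonneg_left h1 (abs_nonneg _)
  refine h2.trans ?_
  nlinarith [sq_nonneg (|a| * ‖ψ X‖ - ‖w‖), sq_abs a, norm_nonneg (ψ X), norm_nonneg w, abs_nonneg a]

/-- **Kinetic density of `Hψ` is dominated**: `|∇(Hψ)|² ≤ 2H²|∇ψ|² + 2(Σ(∂H)²)|ψ|²` (real form). [folklore] -/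
theorem kineticDensity_realMul_toReal_le {H : Config n → ℝ} (hH : Differentiable ℝ H) {ψ : Config n → ℂ}
    (hψ : Differentiable ℝ ψ) (X : Config n) :
    (kineticDensity (fun X : Config n => (H X : ℂ) * ψ X) X).toReal ≤
      2 * (H X) ^ 2 * (kineticDensity ψ X).toReal +
        2 * (∑ i : Fin n, ∑ k : Fin 3, (fderiv ℝ H X (Pi.single i (EuclideanSpace.single k (1 : ℝ)))) ^ 2) *
          ‖ψ X‖ ^ 2 := by
  rw [kineticDensity_realMul_toReal hH hψ]
  have hc := abs_cross_le H ψ X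
  have hH2 : |H X| * |∑ i : Fin n, ∑ k : Fin 3,
      fderiv ℝ H X (Pi.single i (EuclideanSpace.single k (1 : ℝ))) *
        inner ℝ (ψ X) (fderiv ℝ ψ X (Pi.single i (EuclideanSpace.single k (1 : ℝ))))| ≤
      ((H X) ^ 2 * (kineticDensity ψ X).toReal +
        (∑ i : Fin n, ∑ k : Fin 3, (fderiv ℝ H X (Pi.single i (EuclideanSpace.single k (1 : ℝ)))) ^ 2) *
          ‖ψ X‖ ^ 2) / 2 := by
    -- AM-GM with the weight `|H|`: `|H| · |c| ≤ (H² T + S ρ)/2` from `|c| ≤ (S ρ + T)/2` is too weak in general;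
    -- use instead termwise `|H a ⟨ψ,w⟩| ≤ (H²‖w‖² + a²‖ψ‖²)/2`.
    rw [← abs_mul, Finset.mul_sum, kineticDensity_toReal, Finset.mul_sum, Finset.sum_mul, ← Finset.sum_add_distrib,
      Finset.sum_div]
    refine (Finset.abs_sum_le_sum_abs _ _).trans (Finset.sum_le_sum fun i _ => ?_)
    rw [Finset.mul_sum, Finset.mul_sum, Finset.sum_mul, ← Finset.sum_add_distrib, Finset.sum_div]
    refine (Finset.abs_sum_le_sum_abs _ _).trans (Finset.sum_le_sum fun k _ => ?_)
    set a := fderiv ℝ H X (Pi.single i (EuclideanSpace.single k (1 : ℝ)))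
    set w := fderiv ℝ ψ X (Pi.single i (EuclideanSpace.single k (1 : ℝ)))
    have h1 : |inner ℝ (ψ X) w| ≤ ‖ψ X‖ * ‖w‖ := abs_real_inner_le_norm _ _
    rw [abs_mul, abs_mul]
    have h2 : |H X| * (|a| * |inner ℝ (ψ X) w|) ≤ |H X| * (|a| * (‖ψ X‖ * ‖w‖)) :=
      mul_le_mul_of_nonneg_left (mul_le_mul_of_nonneg_left h1 (abs_nonneg _)) (abs_nonneg _)
    refine h2.trans ?_
    nlinarith [sq_nonneg (|H X| * ‖w‖ - |a| * ‖ψ X‖), sq_abs a, sq_abs (H X), norm_nonneg (ψ X), norm_nonneg w,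
      abs_nonneg a, abs_nonneg (H X)]
  have h3 : 2 * H X * ∑ i : Fin n, ∑ k : Fin 3,
      fderiv ℝ H X (Pi.single i (EuclideanSpace.single k (1 : ℝ))) *
        inner ℝ (ψ X) (fderiv ℝ ψ X (Pi.single i (EuclideanSpace.single k (1 : ℝ)))) ≤
      (H X) ^ 2 * (kineticDensity ψ X).toReal +
        (∑ i : Fin n, ∑ k : Fin 3, (fderiv ℝ H X (Pi.single i (EuclideanSpace.single k (1 : ℝ)))) ^ 2) *
          ‖ψ X‖ ^ 2 := by
    have := le_abs_self (H X * ∑ i : Fin n, ∑ k : Fin 3,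
      fderiv ℝ H X (Pi.single i (EuclideanSpace.single k (1 : ℝ))) *
        inner ℝ (ψ X) (fderiv ℝ ψ X (Pi.single i (EuclideanSpace.single k (1 : ℝ)))))
    rw [abs_mul] at this
    linarith
  nlinarith [h3, sq_nonneg (H X), ENNReal.toReal_nonneg (a := kineticDensity ψ X), norm_nonneg (ψ X),
    Finset.sum_nonneg (fun i (_ : i ∈ Finset.univ) => Finset.sum_nonneg fun k (_ : k ∈ Finset.univ) =>
      sq_nonneg (fderiv ℝ H X (Pi.single i (EuclideanSpace.single k (1 : ℝ)))))]

end FVCalc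

/-- **Registered helper stub `stub_kineticDensityRealMul`** (lead, for `stub_firstVariation`): the real expansion of the
kinetic density of `(H : ℂ) ψ`. [folklore] -/
theorem stub_kineticDensityRealMul :
    ∀ (n : ℕ) (H : Literature.MathematicalPhysics.QuantumManyBody.BoseGas.Config n → ℝ), Differentiable ℝ H →
      ∀ (ψ : Literature.MathematicalPhysics.QuantumManyBody.BoseGas.Config n → ℂ), Differentiable ℝ ψ →
      ∀ X : Literature.MathematicalPhysics.QuantumManyBody.BoseGas.Config n,
        (Literature.MathematicalPhysics.QuantumManyBody.BoseGas.kineticDensity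
            (fun X : Literature.MathematicalPhysics.QuantumManyBody.BoseGas.Config n => (H X : ℂ) * ψ X) X).toReal =
          (∑ i : Fin n, ∑ k : Fin 3, (fderiv ℝ H X (Pi.single i (EuclideanSpace.single k (1 : ℝ)))) ^ 2) * ‖ψ X‖ ^ 2 +
            (H X) ^ 2 * (Literature.MathematicalPhysics.QuantumManyBody.BoseGas.kineticDensity ψ X).toReal +
            2 * H X * ∑ i : Fin n, ∑ k : Fin 3,
              fderiv ℝ H X (Pi.single i (EuclideanSpace.single k (1 : ℝ))) *
                inner ℝ (ψ X) (fderiv ℝ ψ X (Pi.single i (EuclideanSpace.single k (1 : ℝ)))) :=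
  fun _ _ hH _ hψ X => FVCalc.kineticDensity_realMul_toReal hH hψ X

end Summit.AtomisticToContinuum.BoseEinsteinCondensation.Cruxes.OneBodyEntropyBound.Birth

end
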